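import Summits.ABC.IUTFork.Conditional.AbcOfSGenuineMShrink1
import Summits.ABC.IUTFork.Cor312ThetaSideClosedM
import HarnessLib

/-!
# Branch C certificate v10 (INTAKE fold, second step): the HULL-LEVEL line at the summand-route M-LEVEL GENUINE REAL SETTING of every datum with
# the per-packet ORBIT-HULL bound `hA` DISCHARGED BY NAME — per datum S_H 1 ONLY, apex `abc_of_SH_v10M` with 2 explicit hypotheses (`hSH` · `hreg`)

C scoreboard, v10 companion of v9 (`abc_of_SH_v9M`, abc-iut-s2-p12 p441598 ✓: per datum S_H 1 · ORBIT 1 + CONE 1 = 3) and of v8 (`abc_of_SH_v8M`,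
abc-iut-C-cert-3 p440003 ✓: 5): here per datum S_H 1 · ORBIT 0 · PIN 0 · PROV 0 · BRIDGE 0 · READ 0 · SIDE 0 · FACT 0 = 1 (explicit), plus the
(P,l)-level CONE binder `hreg` = **2 explicit at the apex** (`hSH` · `hreg`); EFFECTIVE: tool line on STATUS. For the first time in the campaign
(v0 p427180: 7 explicit / 47 effective) the certificate carries NO Θ-side, q-side, pin, bridge, provenance or side-condition hypothesis: what is
assumed is [S_H] — the hull-level printed clause `Cor312Vol.PilotKummerCompatHull` at the genuine M-level setting of each admissible datum, read
at the pinned region operator (THE ADJUDICATION OBJECT of branch C; refuted-as-typed at deep data, inhabited in the shallow tame window, see the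
C lead's §D) — and [CONE] `hreg`, abc-iut-c312-8's hull-regime residue of [IUTchIV] Thm. 1.10 (TARGET #1). WHAT MOVED (by name, LANDED input):
* [ORBIT] `hA : ∀ i u, (settingMSharp … (tOfIdeleData T.D (ideleDataOf …)) (tqM …) …).thetaLocal (i+1) (Val.non u) ≤ ↑(orbitSumM T.D (ideleDataOf …) i u)`
  (abc-iut-w5-d166 p438889's hypothesis, the [ORBIT] binder of v8/v9) is the THEOREM abc-iut-s2-p8
  `Thm311.Real.thetaLocal_settingMSharp_tOfIdeleData_le_orbitSumM` (p440655 ✓ `Cor312ThetaSideClosedM`, the G1-Θ CLOSER: abc-iut-s2-p7's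
  symmetric slot-content family `exists_symm_slotContentFamily_tThetaM` p439554 ∘ abc-iut-s2-p8's `thetaLocal_settingMSharp_le_coe_sum_content`
  p439950 ∘ `sum_weightM_content_eq_orbitSumM`; RQ7 second read SOUND, abc-iut-s2-p9 11:25:25Z) — for EVERY q-idele family / `Sq` / context
  binder, in particular at v8/v9's (`tqM …`, `(GenuineM.finite_ratPlaces_under_S T.D).toFinset`, `norm_tqM_eq_one_of_not_mem …`). Hence the
  Θ-side READ binder `hΘ` of v0–v7 is a theorem with NO residue at the M-level setting of the datum's own Θ-ideles (abc-iut-w5-d166's G1-Θ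
  programme #2′, (R) p432344 … CLOSER p440655; wording of record STATUS 11:26:37Z).
Everything else is v9 VERBATIM (q-pin by `rfl` at `ρ := fun _ => P.qRegion`; provenance `GenuineMShrink.isSettingOf_settingPrVolSharpM` =
abc-iut-w5-d244 p439939 ∘ abc-iut-w4-d013 p437121; `BridgeHyps` abc-iut-s2-p8 p438078; admissibility guards on `hSH` fed by abc-iut-c312-8's
capstone p428563).

PROOF-ONLY file (no `def`, no new `Prop`, no instance, no notation); nothing re-typed. HONEST FRAMING: this campaign LOCATES / CONDITIONALLY
VERIFIES. Nothing here asserts that abc is proved or refuted, or that [IUTchIII] Cor. 3.12 / Thm. 3.11 holds or fails, or takes a side on any author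
(Mochizuki / Scholze–Stix / Joshi / Dupuy–Hilado); «`ABC` follows from S_H + `hreg` AS TYPED, at these data», nothing more; S_H is an assumption
label — as typed (per-packet SET inclusion at the sharp boxes) it is STRONGER THAN PRINT at exactly one place ([IUTchIII] p. 184, the hedged
volume-level membership; VERDICT §D) and is kernel-REFUTED at deep data (`not_hSH_v6K_of_exists_deep` p438886 for the K-line; the depth theorems
p439248 / p437388 / p437756) while inhabited in the shallow tame window (p439445); typed ≠ proved; instantiated ≠ endorsed.
[claim: Mochizuki2012, status: disputed] [cite: Mochizuki2012, IUTchI Def. 3.1 (e) p. 62; IUTchIII Cor. 3.12 p. 173–174, Step (xi-d) p. 183, (xi-f)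
p. 184; IUTchIV Thm. 1.10 Steps (v)–(vi) p. 27–30, p. 23] [cite: DupuyHilado2025, §3.4, §3.9, Thm. 3.10.1, §4.9–§4.10]
-/

noncomputable section

open Set Function NumberField IsDedekindDomain

namespace Summit.ABC.IUTFork.Conditional

open Thm311 Thm311.Real Cor312 Cor312Vol Cor312Prov Literature.IUT.LogThetaLattice Literature.IUT.LogVolume
  Literature.IUT.HodgeTheaters Literature.IUT.LogVolume.ThetaData Literature.NumberTheory.NumberFields

section PerDatum

variable {F K Fbar : Type} [Field F] [NumberField F] [Field K] [NumberField K] [Algebra F K] [Field Fbar]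
  [Algebra F Fbar] [Algebra K Fbar] {E : WeierstrassCurve F} [E.IsElliptic] {l : ℕ} {Pb : BadPlacePredicates K}

variable (D : InitialThetaData F K Fbar E l Pb) {I : ThetaVolumeInput (fieldOfModuli E) K}
  (M : Type) [Field M] [NumberField M]
  (archPk : ∀ (j : (thetaIndexOfInitial D).Label) (vQ : (thetaIndexOfInitial D).VQ),
    Set ((logShellsOfInitialDH D (analyticLogvVal K)).Packet j vQ))
  (archSub : ∀ (j : (thetaIndexOfInitial D).Label) (v : (thetaIndexOfInitial D).V),
    Set ((logShellsOfInitialDH D (analyticLogvVal K)).Packet j ((thetaIndexOfInitial D).over v)))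
  (Ψ : ℤ → ∀ v : (thetaIndexOfInitial D).V, v ∈ (thetaIndexOfInitial D).Vbad →
    Set ((logShellsOfInitialDH D (analyticLogvVal K)).StarPacket v))
  (act : ℤ → ∀ v : (thetaIndexOfInitial D).V, v ∈ (thetaIndexOfInitial D).Vbad →
    (logShellsOfInitialDH D (analyticLogvVal K)).StarPacket v →
      Module.End ℚ ((logShellsOfInitialDH D (analyticLogvVal K)).StarPacket v))
  (Mmod : ℤ → ∀ j : (thetaIndexOfInitial D).LabelStar, Set ((logShellsOfInitialDH D (analyticLogvVal K)).GlobalPacket j.1))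
  (region : ℤ → ∀ j : (thetaIndexOfInitial D).LabelStar, FinDivisor M → ∀ vQ : (thetaIndexOfInitial D).VQ,
    Set ((logShellsOfInitialDH D (analyticLogvVal K)).Packet j.1 vQ))
  (frobAdm : ℤ → ℤ → ∀ (j : (thetaIndexOfInitial D).Label) (vQ : (thetaIndexOfInitial D).VQ),
    Set ((logShellsOfInitialDH D (analyticLogvVal K)).Packet j vQ) → Prop)
  (frobLogvol : ℤ → ℤ → ∀ (j : (thetaIndexOfInitial D).Label) (vQ : (thetaIndexOfInitial D).VQ),
    Set ((logShellsOfInitialDH D (analyticLogvVal K)).Packet j vQ) → ℝ)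
  (frobΨ : ℤ → ℤ → ∀ v : (thetaIndexOfInitial D).V, v ∈ (thetaIndexOfInitial D).Vbad →
    Set ((logShellsOfInitialDH D (analyticLogvVal K)).StarPacket v))
  (frobMmod : ℤ → ℤ → ∀ j : (thetaIndexOfInitial D).LabelStar, Set ((logShellsOfInitialDH D (analyticLogvVal K)).GlobalPacket j.1))
  (unitImage : ℤ → ℤ → ℕ → ∀ (j : (thetaIndexOfInitial D).Label) (vQ : (thetaIndexOfInitial D).VQ),
    Set ((logShellsOfInitialDH D (analyticLogvVal K)).Packet j vQ))
  (ballImage : ℤ → ℤ → ∀ (j : (thetaIndexOfInitial D).Label) (vQ : (thetaIndexOfInitial D).VQ),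
    Set ((logShellsOfInitialDH D (analyticLogvVal K)).Packet j vQ))
  (thetaDiv : ℤ → ℤ → LgpDivisor M (thetaIndexOfInitial D).lstar)
  (n : ℤ) {HT : Type} {LogLink : HT → HT → Type} {IsFull : ∀ {s t : HT}, LogLink s t → Prop}
  (lat : LGPGaussianLogThetaLattice LogLink IsFull)
  {Frd : Type} {IsoF : Frd → Frd → Type} {Ob : Frd → Type} {realify : Frd → Frd} {Strip : Type}
  {IsoS : Strip → Strip → Type} {Mv : ∀ v : (thetaIndexOfInitial D).V, v ∈ (thetaIndexOfInitial D).Vbad → Type}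
  [∀ v h, Monoid (Mv v h)]
  (sig : GlobalLGPFrobenioidSignature (thetaIndexOfInitial D).lstar (thetaIndexOfInitial D).V
    (· ∈ (thetaIndexOfInitial D).Vbad) Frd IsoF Ob realify Strip IsoS Mv)
  (split : SplittingMonoids Mv) {ObΔ : Type} {N : ∀ v : (thetaIndexOfInitial D).V, v ∈ (thetaIndexOfInitial D).Vbad → Type}
  [∀ v h, Monoid (N v h)] (qData : QPilotData ObΔ N)
  (qK : ∀ v : (thetaIndexOfInitial D).V, v ∈ (thetaIndexOfInitial D).Vbad →
    Set ((logShellsOfInitialDH D (analyticLogvVal K)).StarPacket v))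

/-! ## §1. One datum at the summand-route M-level sharp setting of the datum's OWN ideles, q-region PINNED: `I.Cor312Of` from S_H ALONE -/

/-- **One datum: `I.Cor312Of` from [S_H] alone** — the hull-level printed clause read at `ρ := fun _ => P.qRegion` (free `qK`) at abc-iut-s2-p8's
summand-route M-level sharp setting `P` of the datum's own Θ- and q-ideles; explicit S_H 1 · ORBIT 0 · PIN 0 · PROV 0 · BRIDGE 0 · READ 0 · SIDE 0.
DISCHARGED inside, by name / by construction: v9's `GenuineMShrink.cor312Of_of_SH` (q-pin `rfl`, provenance abc-iut-w5-d244 p439939 ∘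
abc-iut-w4-d013 p437121, `BridgeHyps` abc-iut-s2-p8 p438078, `Statement` abc-iut-w5-d068 p420303, Θ-side modulo `hA` abc-iut-w5-d166 p438889)
with [ORBIT] `hA :=` abc-iut-s2-p8's `thetaLocal_settingMSharp_tOfIdeleData_le_orbitSumM` (p440655, the G1-Θ closer over abc-iut-s2-p7 p439554).
«`I.Cor312Of` follows from S_H as typed, at these data» — no side taken on [IUTchIII] Cor. 3.12. [claim: Mochizuki2012, status: disputed] -/
theorem GenuineMShrink2.cor312Of_of_SH (hI : ThetaData.IsVolumeInputOf D I)
    (hSH : Cor312Vol.PilotKummerCompatHull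
      (LatticeSituation.ofShells (logShellsOfInitialDH D (analyticLogvVal K)) M archPk archSub
        (summandPiecesPrM D (logvAnalyticVal_analyticLogvVal (K := K))).Adm (summandPiecesPrM D (logvAnalyticVal_analyticLogvVal (K := K))).logvol Ψ act Mmod region frobAdm frobLogvol
        frobΨ frobMmod unitImage ballImage thetaDiv)
      (settingPrVolSharpM D (logvAnalyticVal_analyticLogvVal (K := K)) (tOfIdeleData D (ideleDataOf D hI))
        (fun u x => tqM D (ratChar u) u (natCast_ratChar_mem u) (ideleDataOf D hI) x) M archPk archSub Ψ act Mmod region n lat sig split qData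
        (fun u x => tqM_ne_zero D (ratChar u) u (natCast_ratChar_mem u) (ideleDataOf D hI) x)
        (GenuineM.finite_ratPlaces_under_S D).toFinset
        (fun u x hu => norm_tqM_eq_one_of_not_mem D (ratChar u) u (natCast_ratChar_mem u) (ideleDataOf D hI) x
          fun hx => hu ((Set.Finite.mem_toFinset _).mpr ⟨x, hx⟩)))
      (fun _ => Cor312.Setting.qRegion
        (settingPrVolSharpM D (logvAnalyticVal_analyticLogvVal (K := K)) (tOfIdeleData D (ideleDataOf D hI))
        (fun u x => tqM D (ratChar u) u (natCast_ratChar_mem u) (ideleDataOf D hI) x) M archPk archSub Ψ act Mmod region n lat sig split qData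
        (fun u x => tqM_ne_zero D (ratChar u) u (natCast_ratChar_mem u) (ideleDataOf D hI) x)
        (GenuineM.finite_ratPlaces_under_S D).toFinset
        (fun u x hu => norm_tqM_eq_one_of_not_mem D (ratChar u) u (natCast_ratChar_mem u) (ideleDataOf D hI) x
          fun hx => hu ((Set.Finite.mem_toFinset _).mpr ⟨x, hx⟩)))) qK) :
    I.Cor312Of :=
  GenuineMShrink.cor312Of_of_SH D M archPk archSub Ψ act Mmod region frobAdm frobLogvol frobΨ frobMmod unitImage ballImage thetaDiv n lat
    sig split qData qK hI hSH
    (thetaLocal_settingMSharp_tOfIdeleData_le_orbitSumM D (logvAnalyticVal_analyticLogvVal (K := K)) (ideleDataOf D hI)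
      (fun u x => tqM D (ratChar u) u (natCast_ratChar_mem u) (ideleDataOf D hI) x) M archPk archSub Ψ act Mmod region n lat sig split qData
      (fun u x => tqM_ne_zero D (ratChar u) u (natCast_ratChar_mem u) (ideleDataOf D hI) x) (GenuineM.finite_ratPlaces_under_S D).toFinset
      (fun u x hu => norm_tqM_eq_one_of_not_mem D (ratChar u) u (natCast_ratChar_mem u) (ideleDataOf D hI) x
        fun hx => hu ((Set.Finite.mem_toFinset _).mpr ⟨x, hx⟩)))

end PerDatum

/-! ## §2. The apex: `ABC` from S_H (pinned reading) per datum and the hull-regime cone `hreg` — 2 explicit hypotheses -/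

section Family

open Literature.NumberTheory.DiophantineGeometry.GenEll Summit.ABC.ABC.Theorems

/-- **`abc_of_SH_v10M` (branch C certificate v10 = v9 with the orbit-hull bound discharged: HULL-LEVEL line AT THE SUMMAND-ROUTE M-LEVEL
GENUINE REAL SETTING of each datum — carriers `K_{v̲}`, `v̲ ∈ V̲`, pilot regions read off the datum's OWN ideles, q-region PINNED; per datum explicit
S_H 1 · ORBIT 0 · PIN 0 · PROV 0 · BRIDGE 0 · READ 0 · SIDE 0 · FACT 0, plus the (P,l)-level CONE binder `hreg` = 2 explicit).** `ABC` from, per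
`λ`-line point `P`, prime `l` and genuine Θ-volume datum `T`: DATA = the context binders of abc-iut-s2-p8's `settingPrVolSharpM T.D …` (logs FIXED:
analytic; free columns) and PR-1's uninterpreted q-datum `qK` — NO `ρ`, NO pilot-data / provenance-data / field / idele binder; HYPOTHESES = [S_H]
`hSH` (at the pinned reading, ADMISSIBLE `(P,l)` only) · [CONE] `hreg` (c312-8 p428563's, verbatim) — NOTHING ELSE: the q-pin, `BridgeHyps`, the
provenance link, the q-number and the Θ-side identification `−|log Θ|(setting) ≤ −|log Θ|(datum)` are THEOREMS inside (`rfl` / abc-iut-s2-p8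
p438078 / abc-iut-w5-d244 p439939 ∘ abc-iut-w4-d013 p437121 / abc-iut-w5-d166 p438889 ∘ abc-iut-s2-p8 p440655). Proof:
`ThetaPartII.ABC_of_cor312_of_hullRegime` (p428563) over the per-datum theorem `GenuineMShrink2.cor312Of_of_SH` at `T.D`, `T.I`, `T.isVolumeInputOf`.
«`ABC` follows from S_H + `hreg` as typed, at these data» — no side taken on [IUTchIII] Cor. 3.12; typed ≠ proved; instantiated ≠ endorsed.
[claim: Mochizuki2012, status: disputed] -/
theorem abc_of_SH_v10M
    -- DATA, per datum: the context binders of the summand-route M-level sharp setting (logs FIXED: analytic), the column data, qK (ρ is PINNED to the q-region)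
    (M : ∀ (P : NFPoint) (l : ℕ) (T : Cor22.ThetaVolumeDatumAt P l), Type) [∀ P l T, Field (M P l T)] [∀ P l T, NumberField (M P l T)]
    (archPk : ∀ (P : NFPoint) (l : ℕ) (T : Cor22.ThetaVolumeDatumAt P l), letI := T.instFieldF; letI := T.instNumberFieldF; letI := T.instAlgebraF; letI := T.instFieldK;
        letI := T.instNumberFieldK; letI := T.instAlgebraK; letI := T.instFieldFbar; letI := T.instAlgebraFbar;
        letI := T.instAlgebraKFbar; letI := T.instIsElliptic;
      ∀ (j : (thetaIndexOfInitial T.D).Label) (vQ : (thetaIndexOfInitial T.D).VQ), Set ((logShellsOfInitialDH T.D (analyticLogvVal T.K)).Packet j vQ))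
    (archSub : ∀ (P : NFPoint) (l : ℕ) (T : Cor22.ThetaVolumeDatumAt P l), letI := T.instFieldF; letI := T.instNumberFieldF; letI := T.instAlgebraF; letI := T.instFieldK;
        letI := T.instNumberFieldK; letI := T.instAlgebraK; letI := T.instFieldFbar; letI := T.instAlgebraFbar;
        letI := T.instAlgebraKFbar; letI := T.instIsElliptic;
      ∀ (j : (thetaIndexOfInitial T.D).Label) (v : (thetaIndexOfInitial T.D).V), Set ((logShellsOfInitialDH T.D (analyticLogvVal T.K)).Packet j ((thetaIndexOfInitial T.D).over v)))
    (Ψ : ∀ (P : NFPoint) (l : ℕ) (T : Cor22.ThetaVolumeDatumAt P l), letI := T.instFieldF; letI := T.instNumberFieldF; letI := T.instAlgebraF; letI := T.instFieldK;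
        letI := T.instNumberFieldK; letI := T.instAlgebraK; letI := T.instFieldFbar; letI := T.instAlgebraFbar;
        letI := T.instAlgebraKFbar; letI := T.instIsElliptic;
      ℤ → ∀ v : (thetaIndexOfInitial T.D).V, v ∈ (thetaIndexOfInitial T.D).Vbad → Set ((logShellsOfInitialDH T.D (analyticLogvVal T.K)).StarPacket v))
    (act : ∀ (P : NFPoint) (l : ℕ) (T : Cor22.ThetaVolumeDatumAt P l), letI := T.instFieldF; letI := T.instNumberFieldF; letI := T.instAlgebraF; letI := T.instFieldK;
        letI := T.instNumberFieldK; letI := T.instAlgebraK; letI := T.instFieldFbar; letI := T.instAlgebraFbar;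
        letI := T.instAlgebraKFbar; letI := T.instIsElliptic;
      ℤ → ∀ v : (thetaIndexOfInitial T.D).V, v ∈ (thetaIndexOfInitial T.D).Vbad → (logShellsOfInitialDH T.D (analyticLogvVal T.K)).StarPacket v → Module.End ℚ ((logShellsOfInitialDH T.D (analyticLogvVal T.K)).StarPacket v))
    (Mmod : ∀ (P : NFPoint) (l : ℕ) (T : Cor22.ThetaVolumeDatumAt P l), letI := T.instFieldF; letI := T.instNumberFieldF; letI := T.instAlgebraF; letI := T.instFieldK;
        letI := T.instNumberFieldK; letI := T.instAlgebraK; letI := T.instFieldFbar; letI := T.instAlgebraFbar;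
        letI := T.instAlgebraKFbar; letI := T.instIsElliptic;
      ℤ → ∀ j : (thetaIndexOfInitial T.D).LabelStar, Set ((logShellsOfInitialDH T.D (analyticLogvVal T.K)).GlobalPacket j.1))
    (region : ∀ (P : NFPoint) (l : ℕ) (T : Cor22.ThetaVolumeDatumAt P l), letI := T.instFieldF; letI := T.instNumberFieldF; letI := T.instAlgebraF; letI := T.instFieldK;
        letI := T.instNumberFieldK; letI := T.instAlgebraK; letI := T.instFieldFbar; letI := T.instAlgebraFbar;
        letI := T.instAlgebraKFbar; letI := T.instIsElliptic;
      ℤ → ∀ j : (thetaIndexOfInitial T.D).LabelStar, FinDivisor (M P l T) → ∀ vQ : (thetaIndexOfInitial T.D).VQ, Set ((logShellsOfInitialDH T.D (analyticLogvVal T.K)).Packet j.1 vQ))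
    (frobAdm : ∀ (P : NFPoint) (l : ℕ) (T : Cor22.ThetaVolumeDatumAt P l), letI := T.instFieldF; letI := T.instNumberFieldF; letI := T.instAlgebraF; letI := T.instFieldK;
        letI := T.instNumberFieldK; letI := T.instAlgebraK; letI := T.instFieldFbar; letI := T.instAlgebraFbar;
        letI := T.instAlgebraKFbar; letI := T.instIsElliptic;
      ℤ → ℤ → ∀ (j : (thetaIndexOfInitial T.D).Label) (vQ : (thetaIndexOfInitial T.D).VQ), Set ((logShellsOfInitialDH T.D (analyticLogvVal T.K)).Packet j vQ) → Prop)
    (frobLogvol : ∀ (P : NFPoint) (l : ℕ) (T : Cor22.ThetaVolumeDatumAt P l), letI := T.instFieldF; letI := T.instNumberFieldF; letI := T.instAlgebraF; letI := T.instFieldK;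
        letI := T.instNumberFieldK; letI := T.instAlgebraK; letI := T.instFieldFbar; letI := T.instAlgebraFbar;
        letI := T.instAlgebraKFbar; letI := T.instIsElliptic;
      ℤ → ℤ → ∀ (j : (thetaIndexOfInitial T.D).Label) (vQ : (thetaIndexOfInitial T.D).VQ), Set ((logShellsOfInitialDH T.D (analyticLogvVal T.K)).Packet j vQ) → ℝ)
    (frobΨ : ∀ (P : NFPoint) (l : ℕ) (T : Cor22.ThetaVolumeDatumAt P l), letI := T.instFieldF; letI := T.instNumberFieldF; letI := T.instAlgebraF; letI := T.instFieldK;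
        letI := T.instNumberFieldK; letI := T.instAlgebraK; letI := T.instFieldFbar; letI := T.instAlgebraFbar;
        letI := T.instAlgebraKFbar; letI := T.instIsElliptic;
      ℤ → ℤ → ∀ v : (thetaIndexOfInitial T.D).V, v ∈ (thetaIndexOfInitial T.D).Vbad → Set ((logShellsOfInitialDH T.D (analyticLogvVal T.K)).StarPacket v))
    (frobMmod : ∀ (P : NFPoint) (l : ℕ) (T : Cor22.ThetaVolumeDatumAt P l), letI := T.instFieldF; letI := T.instNumberFieldF; letI := T.instAlgebraF; letI := T.instFieldK;
        letI := T.instNumberFieldK; letI := T.instAlgebraK; letI := T.instFieldFbar; letI := T.instAlgebraFbar;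
        letI := T.instAlgebraKFbar; letI := T.instIsElliptic;
      ℤ → ℤ → ∀ j : (thetaIndexOfInitial T.D).LabelStar, Set ((logShellsOfInitialDH T.D (analyticLogvVal T.K)).GlobalPacket j.1))
    (unitImage : ∀ (P : NFPoint) (l : ℕ) (T : Cor22.ThetaVolumeDatumAt P l), letI := T.instFieldF; letI := T.instNumberFieldF; letI := T.instAlgebraF; letI := T.instFieldK;
        letI := T.instNumberFieldK; letI := T.instAlgebraK; letI := T.instFieldFbar; letI := T.instAlgebraFbar;
        letI := T.instAlgebraKFbar; letI := T.instIsElliptic;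
      ℤ → ℤ → ℕ → ∀ (j : (thetaIndexOfInitial T.D).Label) (vQ : (thetaIndexOfInitial T.D).VQ), Set ((logShellsOfInitialDH T.D (analyticLogvVal T.K)).Packet j vQ))
    (ballImage : ∀ (P : NFPoint) (l : ℕ) (T : Cor22.ThetaVolumeDatumAt P l), letI := T.instFieldF; letI := T.instNumberFieldF; letI := T.instAlgebraF; letI := T.instFieldK;
        letI := T.instNumberFieldK; letI := T.instAlgebraK; letI := T.instFieldFbar; letI := T.instAlgebraFbar;
        letI := T.instAlgebraKFbar; letI := T.instIsElliptic;
      ℤ → ℤ → ∀ (j : (thetaIndexOfInitial T.D).Label) (vQ : (thetaIndexOfInitial T.D).VQ), Set ((logShellsOfInitialDH T.D (analyticLogvVal T.K)).Packet j vQ))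
    (thetaDiv : ∀ (P : NFPoint) (l : ℕ) (T : Cor22.ThetaVolumeDatumAt P l), letI := T.instFieldF; letI := T.instNumberFieldF; letI := T.instAlgebraF; letI := T.instFieldK;
        letI := T.instNumberFieldK; letI := T.instAlgebraK; letI := T.instFieldFbar; letI := T.instAlgebraFbar;
        letI := T.instAlgebraKFbar; letI := T.instIsElliptic;
      ℤ → ℤ → LgpDivisor (M P l T) (thetaIndexOfInitial T.D).lstar)
    (n : ∀ (P : NFPoint) (l : ℕ) (T : Cor22.ThetaVolumeDatumAt P l), ℤ)
    {HT : ∀ (P : NFPoint) (l : ℕ) (T : Cor22.ThetaVolumeDatumAt P l), Type} {LogLink : ∀ (P : NFPoint) (l : ℕ) (T : Cor22.ThetaVolumeDatumAt P l), HT P l T → HT P l T → Type}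
    {IsFull : ∀ (P : NFPoint) (l : ℕ) (T : Cor22.ThetaVolumeDatumAt P l), ∀ {s t : HT P l T}, LogLink P l T s t → Prop}
    (lat : ∀ (P : NFPoint) (l : ℕ) (T : Cor22.ThetaVolumeDatumAt P l), LGPGaussianLogThetaLattice (LogLink P l T) (IsFull P l T))
    {Frd : ∀ (P : NFPoint) (l : ℕ) (T : Cor22.ThetaVolumeDatumAt P l), Type} {IsoF : ∀ (P : NFPoint) (l : ℕ) (T : Cor22.ThetaVolumeDatumAt P l), Frd P l T → Frd P l T → Type} {Ob : ∀ (P : NFPoint) (l : ℕ) (T : Cor22.ThetaVolumeDatumAt P l), Frd P l T → Type}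
    {realify : ∀ (P : NFPoint) (l : ℕ) (T : Cor22.ThetaVolumeDatumAt P l), Frd P l T → Frd P l T} {Strip : ∀ (P : NFPoint) (l : ℕ) (T : Cor22.ThetaVolumeDatumAt P l), Type} {IsoS : ∀ (P : NFPoint) (l : ℕ) (T : Cor22.ThetaVolumeDatumAt P l), Strip P l T → Strip P l T → Type}
    {Mv : ∀ (P : NFPoint) (l : ℕ) (T : Cor22.ThetaVolumeDatumAt P l), letI := T.instFieldF; letI := T.instNumberFieldF; letI := T.instAlgebraF; letI := T.instFieldK;
        letI := T.instNumberFieldK; letI := T.instAlgebraK; letI := T.instFieldFbar; letI := T.instAlgebraFbar;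
        letI := T.instAlgebraKFbar; letI := T.instIsElliptic;
      ∀ v : (thetaIndexOfInitial T.D).V, v ∈ (thetaIndexOfInitial T.D).Vbad → Type}
    [∀ P l T v h, Monoid (Mv P l T v h)]
    (sig : ∀ (P : NFPoint) (l : ℕ) (T : Cor22.ThetaVolumeDatumAt P l), letI := T.instFieldF; letI := T.instNumberFieldF; letI := T.instAlgebraF; letI := T.instFieldK;
        letI := T.instNumberFieldK; letI := T.instAlgebraK; letI := T.instFieldFbar; letI := T.instAlgebraFbar;
        letI := T.instAlgebraKFbar; letI := T.instIsElliptic;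
      GlobalLGPFrobenioidSignature (thetaIndexOfInitial T.D).lstar (thetaIndexOfInitial T.D).V (· ∈ (thetaIndexOfInitial T.D).Vbad) (Frd P l T) (IsoF P l T) (Ob P l T) (realify P l T)
        (Strip P l T) (IsoS P l T) (Mv P l T))
    (split : ∀ (P : NFPoint) (l : ℕ) (T : Cor22.ThetaVolumeDatumAt P l), SplittingMonoids (Mv P l T))
    {ObΔ : ∀ (P : NFPoint) (l : ℕ) (T : Cor22.ThetaVolumeDatumAt P l), Type}
    {N : ∀ (P : NFPoint) (l : ℕ) (T : Cor22.ThetaVolumeDatumAt P l), letI := T.instFieldF; letI := T.instNumberFieldF; letI := T.instAlgebraF; letI := T.instFieldK;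
        letI := T.instNumberFieldK; letI := T.instAlgebraK; letI := T.instFieldFbar; letI := T.instAlgebraFbar;
        letI := T.instAlgebraKFbar; letI := T.instIsElliptic;
      ∀ v : (thetaIndexOfInitial T.D).V, v ∈ (thetaIndexOfInitial T.D).Vbad → Type}
    [∀ P l T v h, Monoid (N P l T v h)] (qData : ∀ (P : NFPoint) (l : ℕ) (T : Cor22.ThetaVolumeDatumAt P l), QPilotData (ObΔ P l T) (N P l T))
    (qK : ∀ (P : NFPoint) (l : ℕ) (T : Cor22.ThetaVolumeDatumAt P l), letI := T.instFieldF; letI := T.instNumberFieldF; letI := T.instAlgebraF; letI := T.instFieldK;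
        letI := T.instNumberFieldK; letI := T.instAlgebraK; letI := T.instFieldFbar; letI := T.instAlgebraFbar;
        letI := T.instAlgebraKFbar; letI := T.instIsElliptic;
      ∀ v : (thetaIndexOfInitial T.D).V, v ∈ (thetaIndexOfInitial T.D).Vbad → Set ((logShellsOfInitialDH T.D (analyticLogvVal T.K)).StarPacket v))
    -- [S_H] the HULL-LEVEL form of the printed clause AT THE PINNED READING (ρ := the setting's own q-region), ADMISSIBLE (P,l) only, AT THESE DATA
    (hSH : ∀ (P : NFPoint), P ∈ UP → ∀ (l : ℕ), l.Prime → 5 ≤ l →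
      Cor22.AdmitsCore P → Cor22.CondP2 P l → Cor22.CondP5 P l → Cor22.CondP6 P l →
      ∀ (T : Cor22.ThetaVolumeDatumAt P l), letI := T.instFieldF; letI := T.instNumberFieldF; letI := T.instAlgebraF; letI := T.instFieldK;
        letI := T.instNumberFieldK; letI := T.instAlgebraK; letI := T.instFieldFbar; letI := T.instAlgebraFbar;
        letI := T.instAlgebraKFbar; letI := T.instIsElliptic;
      Cor312Vol.PilotKummerCompatHull
        (LatticeSituation.ofShells (logShellsOfInitialDH T.D (analyticLogvVal T.K)) (M P l T) (archPk P l T) (archSub P l T)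
          (summandPiecesPrM T.D (logvAnalyticVal_analyticLogvVal (K := T.K))).Adm
          (summandPiecesPrM T.D (logvAnalyticVal_analyticLogvVal (K := T.K))).logvol (Ψ P l T) (act P l T) (Mmod P l T)
          (region P l T) (frobAdm P l T) (frobLogvol P l T) (frobΨ P l T) (frobMmod P l T) (unitImage P l T) (ballImage P l T)
          (thetaDiv P l T))
        (settingPrVolSharpM T.D (logvAnalyticVal_analyticLogvVal (K := T.K)) (tOfIdeleData T.D (ideleDataOf T.D T.isVolumeInputOf))
          (fun u x => tqM T.D (ratChar u) u (natCast_ratChar_mem u) (ideleDataOf T.D T.isVolumeInputOf) x)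
          (M P l T) (archPk P l T) (archSub P l T) (Ψ P l T) (act P l T)
          (Mmod P l T) (region P l T) (n P l T) (lat P l T) (sig P l T) (split P l T) (qData P l T)
          (fun u x => tqM_ne_zero T.D (ratChar u) u (natCast_ratChar_mem u) (ideleDataOf T.D T.isVolumeInputOf) x)
          (GenuineM.finite_ratPlaces_under_S T.D).toFinset
          (fun u x hu => norm_tqM_eq_one_of_not_mem T.D (ratChar u) u (natCast_ratChar_mem u) (ideleDataOf T.D T.isVolumeInputOf) x
            fun hx => hu ((Set.Finite.mem_toFinset _).mpr ⟨x, hx⟩))) 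
        (fun _ => Cor312.Setting.qRegion
        (settingPrVolSharpM T.D (logvAnalyticVal_analyticLogvVal (K := T.K)) (tOfIdeleData T.D (ideleDataOf T.D T.isVolumeInputOf))
          (fun u x => tqM T.D (ratChar u) u (natCast_ratChar_mem u) (ideleDataOf T.D T.isVolumeInputOf) x)
          (M P l T) (archPk P l T) (archSub P l T) (Ψ P l T) (act P l T)
          (Mmod P l T) (region P l T) (n P l T) (lat P l T) (sig P l T) (split P l T) (qData P l T)
          (fun u x => tqM_ne_zero T.D (ratChar u) u (natCast_ratChar_mem u) (ideleDataOf T.D T.isVolumeInputOf) x)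
          (GenuineM.finite_ratPlaces_under_S T.D).toFinset
          (fun u x hu => norm_tqM_eq_one_of_not_mem T.D (ratChar u) u (natCast_ratChar_mem u) (ideleDataOf T.D T.isVolumeInputOf) x
            fun hx => hu ((Set.Finite.mem_toFinset _).mpr ⟨x, hx⟩)))) (qK P l T))
    -- [ORBIT] none (theorem, abc-iut-s2-p8 p440655) · [PIN] none (`rfl`) · [PROV] none (theorem) · [BRIDGE] none (theorem) · [READ] none (theorem) · [FACT] none · [SIDE] none · [CONE] c312-8 p428563's `hreg`, verbatim
    (hreg : ∀ P : NFPoint, P ∈ UP → ∀ l : ℕ, l.Prime → 5 ≤ l →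
      Cor22.AdmitsCore P → Cor22.CondP2 P l → Cor22.CondP5 P l → Cor22.CondP6 P l →
      ∀ T : Cor22.ThetaVolumeDatumAt P l,
        (letI := T.instFieldF; letI := T.instNumberFieldF; letI := T.instAlgebraF; letI := T.instFieldK
         letI := T.instNumberFieldK; letI := T.instAlgebraK; letI := T.instFieldFbar; letI := T.instAlgebraFbar
         letI := T.instAlgebraKFbar; letI := T.instIsElliptic
         ¬ (∀ p ∈ T.I.supportPrimes, ∀ v w : placesOver (fieldOfModuli T.E) p,
            (Summit.ABC.IUTFork.DHData.ofInput T.I).logQloc p v = (Summit.ABC.IUTFork.DHData.ofInput T.I).logQloc p w)) →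
        T.HullEstimateOf
          (((l : ℝ) + 1) / 4 *
            ((1 + 12 * (Cor22.dmod P : ℝ) / l) * (P.logDiff + Cor22.logCondAvoid P {2, l})
              + 2 * Real.log l + 52
              + 20 / 3 * Real.log (((2 ^ 12 * 3 ^ 3 * 5 * Cor22.dmod P : ℕ) : ℝ) * (l : ℝ))
                * (Nat.primeCounting (2 ^ 12 * 3 ^ 3 * 5 * Cor22.dmod P * l) : ℝ))))
    : _root_.ABC := by
  -- [IUTchIII] Cor 3.12 at every ADMISSIBLE genuine Θ-volume datum on the HULL-LEVEL line at the summand-route M-setting, from S_H alone (§1)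
  refine ThetaPartII.ABC_of_cor312_of_hullRegime (fun P hP l hl h5 hc h2 h5' h6 T => ?_) hreg
  letI := T.instFieldF; letI := T.instNumberFieldF; letI := T.instAlgebraF; letI := T.instFieldK
  letI := T.instNumberFieldK; letI := T.instAlgebraK; letI := T.instFieldFbar; letI := T.instAlgebraFbar
  letI := T.instAlgebraKFbar; letI := T.instIsElliptic
  exact GenuineMShrink2.cor312Of_of_SH T.D (M P l T) (archPk P l T) (archSub P l T) (Ψ P l T) (act P l T) (Mmod P l T)
    (region P l T) (frobAdm P l T) (frobLogvol P l T) (frobΨ P l T) (frobMmod P l T) (unitImage P l T) (ballImage P l T)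
    (thetaDiv P l T) (n P l T) (lat P l T) (sig P l T) (split P l T) (qData P l T) (qK P l T) T.isVolumeInputOf
    (hSH P hP l hl h5 hc h2 h5' h6 T)

end Family

end Summit.ABC.IUTFork.Conditional

end
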